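import Mathlib.RingTheory.DedekindDomain.IntegralClosure
import Mathlib.RingTheory.DedekindDomain.AdicValuation
import Mathlib.RingTheory.AlgebraicIndependent.TranscendenceBasis
import Mathlib.FieldTheory.IntermediateField.Adjoin.Algebra
import Mathlib.RingTheory.Algebraic.Integral
import HarnessLib

/-!
# Discrete valuations of a finitely generated field, trivial on the constants

For a field `L` finitely generated over a subfield `K` of characteristic zero and an element
`z ∈ L` transcendental over `K`, there is a discrete valuation `v : L → ℤₘ₀` which is trivial on
`Kˣ` and satisfies `v(z) < 1` (a "zero of `z`"): complete `z` to a transcendence basis `t` of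
`L/K`, let `K₁ = K(t ∖ {z})`, so that `R₁ = K₁[z] ≅ K₁[X]` is a principal ideal domain with
fraction field `K₁(z) = K(t)`, over which `L` is finite (and separable); the integral closure
`C` of `R₁` in `L` is a Dedekind domain with fraction field `L`, and the adic valuation of any
prime of `C` above `(z) ⊂ R₁` does the job (Lang, *Algebra*, VII §1 and XII §4; the
divisor/valuation-theoretic form of "a non-constant function has a zero").

This is the valuation-theoretic input for the finite generation of groups of radicals
`{x ∈ Lˣ : xʲ ∈ ⟨a₁, …, a_N⟩ Kˣ}/Kˣ` (Kummer theory over function fields; Bays–Kirby 2018,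
Prop. 3.24 in the torus case).

* `Literature.exists_valuation_lt_one_of_transcendental`.

## References

* S. Lang, *Algebra*, 3rd ed., GTM 211, Springer 2002, VII §1 (integral closure, Prop. 1.?),
  XII §4 (valuations).
-/

noncomputable section

open scoped IntermediateField.algebraAdjoinAdjoin

namespace Literature.FieldTheory.Kummer

namespace ConstantsValuation

universe u

variable {K L : Type u} [Field K] [Field L] [Algebra K L]

/-- Step 1: a transcendental element extends to a transcendence basis. [folklore] -/
theorem exists_isTranscendenceBasis_mem {z : L} (hz : Transcendental K z) :
    ∃ t : Set L, z ∈ t ∧ IsTranscendenceBasis K ((↑) : t → L) := by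
  have hs : AlgebraicIndepOn K id ({z} : Set L) := by
    rw [AlgebraicIndepOn]
    have : AlgebraicIndependent K (fun _ : ({z} : Set L) => z) ↔ Transcendental K z :=
      algebraicIndependent_unique_type_iff
    convert this.2 hz using 1
    ext ⟨x, hx⟩
    simp [Set.mem_singleton_iff.1 hx]
  obtain ⟨t, hzt, ht⟩ := exists_isTranscendenceBasis_superset hs
  exact ⟨t, hzt (Set.mem_singleton z), ht⟩

/-- Step 2: `z` is transcendental over `K(t ∖ {z})` for a transcendence basis `t ∋ z`.
[folklore] -/
theorem transcendental_adjoin_diff {z : L} {t : Set L} (hzt : z ∈ t)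
    (ht : IsTranscendenceBasis K ((↑) : t → L)) :
    Transcendental (IntermediateField.adjoin K (t \ {z})) z := by
  -- over the subalgebra `K[t ∖ {z}]`
  have h1 : Transcendental (Algebra.adjoin K (t \ {z})) z := by
    have h := ht.1.transcendental_adjoin (s := {i : t | (i : L) ≠ z}) (i := ⟨z, hzt⟩)
      (by simp)
    have himg : ((↑) : t → L) '' {i : t | (i : L) ≠ z} = t \ {z} := by
      ext x
      simp only [Set.mem_image, Set.mem_setOf_eq, Set.mem_sdiff, Set.mem_singleton_iff]
      constructor
      · rintro ⟨⟨y, hy⟩, hne, rfl⟩; exact ⟨hy, hne⟩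
      · rintro ⟨hx, hne⟩; exact ⟨⟨x, hx⟩, hne, rfl⟩
    rwa [himg] at h
  -- pass to the fraction field `K(t ∖ {z})`
  intro halg
  exact h1 ((IsFractionRing.isAlgebraic_iff (Algebra.adjoin K (t \ {z}))
    (IntermediateField.adjoin K (t \ {z})) L).2 halg)

/-- `K₁[z] ≅ K₁[X]` for `z` transcendental over `K₁`: the subalgebra generated by a
transcendental element is a principal ideal domain, and `z` is a prime element of it.
[folklore] -/
theorem isPrincipalIdealRing_adjoin_of_transcendental {K₁ : Type u} [Field K₁] [Algebra K₁ L]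
    {z : L} (hztr : Transcendental K₁ z) :
    IsPrincipalIdealRing (Algebra.adjoin K₁ ({z} : Set L)) ∧
      Prime (⟨z, Algebra.self_mem_adjoin_singleton K₁ z⟩ : Algebra.adjoin K₁ ({z} : Set L)) := by
  have hinj : Function.Injective (Polynomial.aeval (R := K₁) z) :=
    (transcendental_iff_injective (R := K₁) (x := z)).1 hztr
  have hrange : (Polynomial.aeval (R := K₁) z).range = Algebra.adjoin K₁ ({z} : Set L) :=
    (Algebra.adjoin_singleton_eq_range_aeval K₁ z).symm
  let e : Polynomial K₁ ≃ₐ[K₁] Algebra.adjoin K₁ ({z} : Set L) :=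
    (AlgEquiv.ofInjective (Polynomial.aeval z) hinj).trans (Subalgebra.equivOfEq _ _ hrange)
  have heX : e Polynomial.X = ⟨z, Algebra.self_mem_adjoin_singleton K₁ z⟩ := by
    apply Subtype.ext
    change ((Polynomial.aeval z Polynomial.X : L)) = z
    exact Polynomial.aeval_X z
  refine ⟨IsPrincipalIdealRing.of_surjective e.toRingEquiv.toRingHom e.surjective, ?_⟩
  rw [← heX]
  exact (MulEquiv.prime_iff e.toMulEquiv).2 Polynomial.prime_X

/-- **The valuation, relative to an intermediate base `K₁`.** If `z ∈ L` is transcendental over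
a subfield `K₁` (characteristic `0`) and `L` is finite over `K₁(z)`, there is a valuation
`v : L → ℤₘ₀` with `v(K₁ˣ) = 1`, `v(z) < 1`, `v(z) ≠ 0`: the adic valuation of a prime of the
integral closure of `K₁[z]` in `L` lying above `(z)`. [cite: Lang2002, VII §1 and XII §4] -/
theorem exists_valuation_lt_one_of_transcendental_aux {K₁ : Type u} [Field K₁] [CharZero K₁]
    [Algebra K₁ L] {z : L} (hztr : Transcendental K₁ z)
    [FiniteDimensional (IntermediateField.adjoin K₁ ({z} : Set L)) L] :
    ∃ v : Valuation L (WithZero (Multiplicative ℤ)),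
      (∀ x : K₁, x ≠ 0 → v (algebraMap K₁ L x) = 1) ∧ v z < 1 ∧ v z ≠ 0 := by
  classical
  have hz0 : z ≠ 0 := fun h => hztr (h ▸ isAlgebraic_zero)
  set R₁ : Subalgebra K₁ L := Algebra.adjoin K₁ ({z} : Set L) with hR₁
  set L₀ : IntermediateField K₁ L := IntermediateField.adjoin K₁ ({z} : Set L) with hL₀
  have hzR₁ : z ∈ R₁ := Algebra.self_mem_adjoin_singleton K₁ z
  obtain ⟨hPID, hprime⟩ := isPrincipalIdealRing_adjoin_of_transcendental hztr
  haveI : IsPrincipalIdealRing R₁ := hPID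
  haveI : IsDedekindDomain R₁ := inferInstance
  -- the integral closure `C` of `R₁` in `L`: a Dedekind domain with fraction field `L`
  set C : Subalgebra R₁ L := integralClosure R₁ L with hC
  haveI : IsDedekindDomain C := integralClosure.isDedekindDomain R₁ L₀ L
  haveI : IsFractionRing C L := IsIntegralClosure.isFractionRing_of_finite_extension R₁ L₀ L C
  -- the prime `(z) ⊂ R₁` and a prime `Q` of `C` above it
  set zR : R₁ := ⟨z, hzR₁⟩ with hzR
  set 𝔭 : Ideal R₁ := Ideal.span {zR} with h𝔭
  haveI h𝔭prime : 𝔭.IsPrime := (Ideal.span_singleton_prime hprime.ne_zero).2 hprime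
  have hcomap : (⊥ : Ideal C).comap (algebraMap R₁ C) ≤ 𝔭 := by
    intro r hr
    rw [Ideal.mem_comap, Ideal.mem_bot] at hr
    have : (r : L) = 0 := by
      have := congrArg (fun x : C => (x : L)) hr
      simpa using this
    have hr0 : r = 0 := Subtype.ext this
    rw [hr0]; exact zero_mem _
  obtain ⟨Q, -, hQprime, hQ⟩ := Ideal.exists_ideal_over_prime_of_isIntegral 𝔭 (⊥ : Ideal C) hcomap
  have hzC : z ∈ C := by
    rw [hC, mem_integralClosure_iff]
    exact isIntegral_algebraMap (A := L) (x := zR)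
  set zC : C := ⟨z, hzC⟩ with hzCdef
  have hzCQ : zC ∈ Q := by
    have : algebraMap R₁ C zR = zC := Subtype.ext rfl
    rw [← this, ← Ideal.mem_comap, hQ]
    exact Ideal.subset_span (Set.mem_singleton zR)
  have hQne : Q ≠ ⊥ := by
    intro h
    rw [h] at hzCQ
    rw [Ideal.mem_bot] at hzCQ
    exact hz0 (congrArg (fun x : C => (x : L)) hzCQ)
  -- the adic valuation of `Q`
  let Qh : IsDedekindDomain.HeightOneSpectrum C := ⟨Q, hQprime, hQne⟩
  refine ⟨Qh.valuation L, fun x hx => ?_, ?_, ?_⟩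
  · -- `x ∈ K₁ˣ` is a unit of `C`
    have hmemC : ∀ y : K₁, algebraMap K₁ L y ∈ C := fun y => by
      have : algebraMap K₁ L y ∈ R₁ := R₁.algebraMap_mem y
      rw [hC, mem_integralClosure_iff]
      exact isIntegral_algebraMap (A := L) (x := (⟨_, this⟩ : R₁))
    have h1 : Qh.valuation L (algebraMap K₁ L x) ≤ 1 := Qh.valuation_le_one (⟨_, hmemC x⟩ : C)
    have h2 : Qh.valuation L (algebraMap K₁ L x)⁻¹ ≤ 1 := by
      rw [← map_inv₀]
      exact Qh.valuation_le_one (⟨_, hmemC x⁻¹⟩ : C)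
    have hx0 : algebraMap K₁ L x ≠ 0 := (map_ne_zero_iff _ (algebraMap K₁ L).injective).2 hx
    rw [map_inv₀] at h2
    refine le_antisymm h1 ?_
    have h3 : (Qh.valuation L (algebraMap K₁ L x))⁻¹ * Qh.valuation L (algebraMap K₁ L x) = 1 :=
      inv_mul_cancel₀ ((Valuation.ne_zero_iff _).2 hx0)
    calc (1 : WithZero (Multiplicative ℤ))
        = (Qh.valuation L (algebraMap K₁ L x))⁻¹ * Qh.valuation L (algebraMap K₁ L x) := h3.symm
      _ ≤ 1 * Qh.valuation L (algebraMap K₁ L x) := by gcongr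
      _ = Qh.valuation L (algebraMap K₁ L x) := one_mul _
  · -- `v(z) < 1` since `z ∈ Q`
    exact (IsDedekindDomain.HeightOneSpectrum.valuation_lt_one_iff_mem Qh zC).2 hzCQ
  · exact (Valuation.ne_zero_iff _).2 hz0

/-- `L` is finite over `K(t ∖ {z})(z) = K(t)` when `L = K(s)` is finitely generated and `t` is a
transcendence basis. [folklore] -/
theorem finiteDimensional_adjoin_adjoin (hfg : ∃ s : Finset L, IntermediateField.adjoin K (s : Set L) = ⊤)
    (z : L) {t : Set L} (ht : IsTranscendenceBasis K ((↑) : t → L)) :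
    FiniteDimensional (IntermediateField.adjoin (IntermediateField.adjoin K (t \ {z})) ({z} : Set L)) L := by
  classical
  set K₁ : IntermediateField K L := IntermediateField.adjoin K (t \ {z}) with hK₁
  set L₀ : IntermediateField K₁ L := IntermediateField.adjoin K₁ ({z} : Set L) with hL₀
  obtain ⟨s, hs⟩ := hfg
  -- every element of `L` is algebraic over `K(t)`, hence over `L₀ ⊇ K(t)`
  have halgt : Algebra.IsAlgebraic (IntermediateField.adjoin K t) L := by
    have := ht.isAlgebraic_field
    rwa [Subtype.range_coe] at this
  have hle : (IntermediateField.adjoin K t).toSubalgebra ≤ (L₀.restrictScalars K).toSubalgebra := by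
    intro x hx
    change x ∈ L₀
    have : IntermediateField.adjoin K t ≤ L₀.restrictScalars K := by
      refine IntermediateField.adjoin_le_iff.2 fun y hy => ?_
      change y ∈ L₀
      by_cases hyz : y = z
      · rw [hyz]; exact IntermediateField.subset_adjoin K₁ _ (Set.mem_singleton z)
      · have hyK₁ : y ∈ K₁ := IntermediateField.subset_adjoin K _ ⟨hy, hyz⟩
        exact L₀.algebraMap_mem ⟨y, hyK₁⟩
    exact this hx
  have halg : ∀ x : L, IsAlgebraic L₀ x := fun x => by
    have hx : IsAlgebraic (IntermediateField.adjoin K t) x := halgt.isAlgebraic x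
    exact IsAlgebraic.tower_top_of_subalgebra_le hle hx
  have hfin : FiniteDimensional L₀ (IntermediateField.adjoin L₀ (s : Set L)) :=
    IntermediateField.finiteDimensional_adjoin fun x _ => (halg x).isIntegral
  have htop : IntermediateField.adjoin L₀ (s : Set L) = ⊤ := by
    rw [eq_top_iff]
    intro x _
    have hx : x ∈ (IntermediateField.adjoin K (s : Set L)) := by rw [hs]; trivial
    have hle' : IntermediateField.adjoin K (s : Set L) ≤
        ((IntermediateField.adjoin L₀ (s : Set L)).restrictScalars K₁).restrictScalars K := by
      refine IntermediateField.adjoin_le_iff.2 fun y hy => ?_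
      exact IntermediateField.subset_adjoin L₀ _ hy
    exact hle' hx
  rw [htop] at hfin
  exact IntermediateField.topEquiv.toLinearEquiv.finiteDimensional

variable [CharZero K]

/-- **A discrete valuation trivial on the constants with a zero at a given transcendental
element.** Let `L ⊇ K` be finitely generated as a field over `K` (characteristic `0`) and
`z ∈ L` transcendental over `K`. Then there is a valuation `v : L → ℤₘ₀` with `v(Kˣ) = 1`,
`v(z) < 1` and `v(z) ≠ 0`. (Adic valuation at a prime above `(z)` of the integral closure of
`K(t ∖ {z})[z]` in `L`, `t ∋ z` a transcendence basis.) [cite: Lang2002, VII §1 and XII §4] -/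
theorem exists_valuation_lt_one_of_transcendental
    (hfg : ∃ s : Finset L, IntermediateField.adjoin K (s : Set L) = ⊤)
    {z : L} (hz : Transcendental K z) :
    ∃ v : Valuation L (WithZero (Multiplicative ℤ)),
      (∀ x : K, x ≠ 0 → v (algebraMap K L x) = 1) ∧ v z < 1 ∧ v z ≠ 0 := by
  haveI : CharZero L := charZero_of_injective_algebraMap (algebraMap K L).injective
  obtain ⟨t, hzt, ht⟩ := exists_isTranscendenceBasis_mem hz
  set K₁ : IntermediateField K L := IntermediateField.adjoin K (t \ {z}) with hK₁
  have hztr : Transcendental K₁ z := transcendental_adjoin_diff hzt ht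
  haveI := finiteDimensional_adjoin_adjoin hfg z ht
  obtain ⟨v, hvK₁, hvz, hvz0⟩ := exists_valuation_lt_one_of_transcendental_aux (K₁ := K₁) hztr
  refine ⟨v, fun x hx => ?_, hvz, hvz0⟩
  have := hvK₁ (algebraMap K K₁ x) ((map_ne_zero_iff _ (algebraMap K K₁).injective).2 hx)
  rwa [← IsScalarTower.algebraMap_apply] at this

end ConstantsValuation

end Literature.FieldTheory.Kummer
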